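import Summits.BirchSwinnertonDyer.BirchSwinnertonDyer.Theorems.SchneiderFreeAdditiveX3GordCellThreeAux
import Summits.BirchSwinnertonDyer.BirchSwinnertonDyer.Theorems.SchneiderFreeAdditiveX3GordCellOfKYBranchOnly
import Summits.BirchSwinnertonDyer.BirchSwinnertonDyer.Theorems.SchneiderFreeAdditiveX3UpperGordCellOfPrintNonAnomalousTwist
import Summits.BirchSwinnertonDyer.BirchSwinnertonDyer.Theorems.SignedBaseChangeAnticyclotomicEisensteinDivisibilityLocalEulerPoincareCorank
import Literature.NumberTheory.IwasawaTheory.Greenberg2006.LocalH2VanishingOfLOC1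
import HarnessLib

/-!
# Route `SchneiderFreeAdditiveX3` (K1 door) on the (G-ord, `e = 2`) cell AT `p = 3`, PER PAIR, for the pairs with a NON-ANOMALOUS twist:
# the LOWER half of BSD₃ from PUBLISHED facts ∪ {[DIV.dvd], [AN3], [BR3]}; with generation 25's upper half, `MissingPPartAt W 3` and
# Miller's `BSD(E, 3)` per pair from PUBLISHED facts ∪ {[DIV.dvd], [AN3], [BR3]} ∪ {the pair's twist-unit datum}

Cell `bsd-schneider-ideate`, seat `bsd-schneider-door-c5` (prover, generation 27; assembly layer; `--supports` 19177).
PARTITION: board row B6 ∩ X3 ∩ sst-twist, `r = 1`, (G-ord, `e = 2`) half at `p = 3` (2 411 pairs; the 686 NON-ANOMALOUS ones, census kit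
j319291) of `Rank1Residual.partition` — PER-PAIR ASSEMBLY on top of `…GordCellThreeAux` (p684153, AUX3 discharged); types-the-object-of nothing;
closes none of B6's cells (BSD NOT advanced).  bears_on: K1-door (19177 r3; FYI wing 20365).

WHAT.
* §1 **`missingLowerBoundAt_gordTwo_three_of_printedFacts_of_print_of_forall_twist`** — LOWER half per pair (`MissingLowerBoundAt W 3`:
  `ord₃ #Ш(E)_an ≤ ord₃ #Ш(E)`) for every globally minimal `W` with `r_an = 1`, `ClassX3 W 3`, `SubGordTwo W 3` and NON-ANOMALOUS twists
  (`NAT(W, 3)`) ⟸ `PrintedFacts` ∧ Hsieh 2014 Thm. A ∧ Liu–Zhang–Zhang 2018 ∧ Castella–Hsieh signed ∧ [DIV.dvd] (PREPRINT) ∧ [AN3]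
  (PUB-composed at `p = 3`, audit pending) ∧ [BR3] (PUB) ∧ twelve published facts.  Generation 21's
  `KYBranchOnly.missingLowerBoundAt_gordTwo_of_printedFacts_of_hsieh_of_lzz_of_KY_branch_of_castellaHsieh_signed` VERBATIM at `p = 3` with its
  per-datum door (Keller–Yin's KYb + KYμ) REPLACED by `KYBranchThreeAux.additiveIMCLowerBDPOnTree_subGordTwo_three_offSliver_of_thm212`: the
  Heegner/twist datum with `d_K ≡ 1 (mod 8)` (so `d_K ≠ −3`), STEP L at it from the door + the CLOSED control corner + Kolyvagin, then
  `JointLowerManin` / `PartnerUpperRankZero`.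
* §2 **`missingPPartAt_gordTwo_three_…`**, **`bsdp_gordTwo_three_…`** — with generation 25's UPPER half per pair
  (`UpperOfPrintNonAnomalousTwist.missingUpperBoundAt_gordTwo_odd_of_printedFacts_of_twistUnitAt_of_forall_twist_…`, ⟸ PUB ∪ {[DIV.dvd]} ∪
  {TU, NAT}): `MissingPPartAt W 3` (`ord₃ #Ш(E)_an = ord₃ #Ш(E)`) and Miller's `BSD(E, 3)` for every such pair with the twist-unit datum
  `Upper.TwistUnitFieldOffSliverAt W 3` (certified on all 7 101 census pairs, kit j311179/j312035).

INPUT LEDGER PER PAIR, (G-ord, `e = 2`), `p = 3`, NAT (686 census pairs): PUBLISHED facts (typed, by name) ∪ {[DIV.dvd] = Keller–Yin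
arXiv:2410.23241 Thm. 3.3.6 ∘ Prop. 3.4.4 (PREPRINT; at `p = 3` beyond its printed range `p > 3`), [AN3] (PUB-composed at `p = 3` per memo
FINDING-door-c5-g26 §2, audit pending), [BR3] (PUBLISHED)} ∪ {the pair's twist-unit certificate (upper half only)}.  NO Keller–Yin Thm. 3.5.1
sentence, NO existence hypothesis, NO per-curve hypothesis beyond the cell predicates.

HONEST FRAMING: THEOREMS ONLY; pure composition of tree theorems, CONDITIONAL on the displayed hypotheses; [DIV.dvd] is an unrefereed
PREPRINT sentence; nothing is closed by me; BSD is proved for no curve — per pair this is BSD₃ MODULO {published theorems} ∪ {[DIV.dvd],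
[AN3]} ∪ {the pair's TU certificate}; «closes rung: none».  References: [KellerYin2024b] arXiv:2410.23241 Thm. 3.3.6, Prop. 3.4.4 (preprint);
[CastellaGrossiLeeSkinner2022] Thms. 1.2.2, 2.1.2, 2.2.2, Prop. 14; [CastellaHsieh2018] §3.3; [Hsieh2014] Thm. A; [LiuZhangZhang2018]
Thm 1.5.1/1.5.3; [JetchevSkinnerWan2017] §7.4.1; [Miller2011LMS] Def. 1.1; [GrossZagier1986] I.(6.3), (7.3); [FriedbergHoffstein1995] Thm. B.
-/

set_option autoImplicit false
-- `Summit.<P>.<Sub>` repeats `BirchSwinnertonDyer` by the tree's layout convention (D-0017)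
set_option linter.dupNamespace false

noncomputable section

open scoped Classical NumberField

open Field NumberField IsDedekindDomain WeierstrassCurve
  Literature.NumberTheory.EllipticCurves Literature.NumberTheory.EllipticCurves.GreenbergSelmer
  Literature.NumberTheory.GaloisRepresentations Literature.NumberTheory.GaloisCohomology
  Literature.NumberTheory.EllipticCurves.ModularForms Literature.NumberTheory.EllipticCurves.Rank1Residual
  Literature.NumberTheory.EllipticCurves.Rank1Residual.Typed
  Literature.NumberTheory.EllipticCurves.KellerYin2024 Literature.NumberTheory.EllipticCurves.CaiShuTian2014
  Literature.NumberTheory.IwasawaTheory Literature.NumberTheory.IwasawaTheory.Greenberg2016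
  Literature.NumberTheory.IwasawaTheory.Greenberg2006
  Summit.BirchSwinnertonDyer.Rank1Residual Summit.BirchSwinnertonDyer.Rank1Residual.X11b
  Summit.BirchSwinnertonDyer.Rank1Residual.X11b.AcSelmer Summit.BirchSwinnertonDyer.Rank1Residual.X11b.Halves
  Summit.BirchSwinnertonDyer.BirchSwinnertonDyer.Theorems.SchneiderFree
  Summit.BirchSwinnertonDyer.BirchSwinnertonDyer.Theorems.SchneiderFree.Upper
  Summit.BirchSwinnertonDyer.BirchSwinnertonDyer.Theorems.SchneiderFree.KYRead
  Summit.BirchSwinnertonDyer.BirchSwinnertonDyer.Theses.SchneiderFreeAdditiveX3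
  Summit.BirchSwinnertonDyer.BirchSwinnertonDyer.Theorems.SchneiderFreeAdditiveX3.ControlDischarged
  Summit.BirchSwinnertonDyer.BirchSwinnertonDyer.Theorems.SchneiderFreeAdditiveX3.KYBranchOnly
  Summit.BirchSwinnertonDyer.BirchSwinnertonDyer.Theorems.SchneiderFreeAdditiveX3.KYBranchThreeAux
  Summit.BirchSwinnertonDyer.BirchSwinnertonDyer.Theorems.SchneiderFreeAdditiveX3.UpperOfPrintNonAnomalousTwist
open Literature.NumberTheory.EllipticCurves.CastellaGrossiLeeSkinner2022
  (cor126_residualCharacter_globalLift cor126_residualCharacter_localSurjective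
    prop125_characterGrSelmerDual_torsion_muZero_dim prop14_residualCharacterSelmer_finite thm212_exists_isKatzLFunction)

namespace Summit.BirchSwinnertonDyer.BirchSwinnertonDyer.Theorems.SchneiderFreeAdditiveX3.KYBranchThreePerPair

/-! ### §1 The LOWER half per pair on (G-ord, `e = 2`) at `p = 3`, non-anomalous twists -/

/-- **LOWER half per pair on the (G-ord, `e = 2`) cell AT `p = 3` for a pair with NON-ANOMALOUS twists ⇐ `PrintedFacts` ∧ Hsieh 2014 Thm. A ∧
Liu–Zhang–Zhang 2018 ∧ Castella–Hsieh signed ∧ [DIV.dvd] (PREPRINT) ∧ [AN3] (PUB-composed) ∧ [BR3] (PUB) ∧ twelve published facts — NO crux,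
NO Keller–Yin Thm. 3.5.1 sentence.**  For every globally minimal `W/ℚ` with `r_an = 1`, `ClassX3 W 3`, `SubGordTwo W 3` and `NAT(W, 3)`:
`MissingLowerBoundAt W 3` (`ord₃ #Ш(E)_an ≤ ord₃ #Ш(E)`).  Generation 21's proof at `p = 3`: the Heegner/twist datum with `d_K ≡ 1 (mod 8)`
(Friedberg–Hoffstein; `d_K ≠ −3`), STEP L at it from the per-datum door `KYBranchThreeAux.additiveIMCLowerBDPOnTree_subGordTwo_three_offSliver_of_thm212`
+ the control inequality (CLOSED corner + Kolyvagin), `Ш(E/K)` finite by Kolyvagin, then `JointLowerManin` / `PartnerUpperRankZero`.  CONDITIONAL on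
the displayed hypotheses; closes no item; BSD not advanced beyond this typed reduction. [claim: KellerYin2024PotOrd, status: under-review]
[cite: KellerYin2024b, Thm. 3.3.6 and Prop. 3.4.4 (arXiv:2410.23241 p. 19) (preprint; the Kolyvagin divisibility a hypothesis)]
[cite: CastellaGrossiLeeSkinner2022, Thms. 1.2.2, 2.1.2, 2.2.2, Prop. 14] [cite: JetchevSkinnerWan2017, §7.4.1 (arXiv:1512.06894 p. 30)]
[cite: FriedbergHoffstein1995, Thm. B] [cite: GrossZagier1986, Thm. I.(6.3) and (7.3)] -/
theorem missingLowerBoundAt_gordTwo_three_of_printedFacts_of_print_of_forall_twist (hF : PrintedFacts)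
    (hA : Hsieh2014.thmA_exists_isHsiehLFunction_unrPeriod_anyLevel)
    (hL : LiuZhangZhang2018.thm151_thm153_modularCurve_heegnerVector_additive)
    (hCHσ : castellaHsieh2018_exists_isBranchBDPLFunction_signed)
    (hDVD : thm336_dvd_branch_OPEN) (hAN : thm351_anacong_branch_three) (hBR : thm122_charLambda_pair_three)
    (h212 : thm212_exists_isKatzLFunction)
    (hprop125 : prop125_characterGrSelmerDual_torsion_muZero_dim) (hfact : prop14_residualCharacterSelmer_finite)
    (hlift : cor126_residualCharacter_globalLift) (hlocal : cor126_residualCharacter_localSurjective)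
    (h411 : prop411_selmer_isAlmostDivisible) (h263 : prop263_sur_of_crk) (h41 : prop41_globalEulerPoincareCorank)
    (h42 : prop42_localEulerPoincareCorank) (h5A : sec5A_localH2_subsingleton_of_LOC1)
    (h32 : prop32_cohomology_isCofinitelyGenerated) :
    ∀ (W : WeierstrassCurve ℚ) [W.IsElliptic] [W.IsGloballyMinimal],
      W.analyticRank = 1 → ClassX3 W 3 → Additive.SubGordTwo W 3 →
      (∀ (V : WeierstrassCurve ℚ) [V.IsElliptic] [V.IsGloballyMinimal] (C : VariableChange ℚ),
        GoodOrd V 3 → C • V.quadraticTwist ((-1 : ℚ) ^ (3 / 2) * (3 : ℕ)) = W → ¬ (3 : ℤ) ∣ V.frobeniusTrace 3 - 1) →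
      MissingLowerBoundAt W 3 := by
  have hJ : JointLowerManin := schneiderFreeAdditiveX3_jointLowerManin_proof
  have hU : PartnerUpperRankZero := schneiderFreeAdditiveX3_partnerUpperRankZero_proof
  obtain ⟨hGZ, hKo, hGZK, hmod, hmodD, hCas, hGZ73, hFH, hpar, hHP, hDel, hW16, hWu⟩ := hF
  intro W _ _ hr hX hG hna
  have hp2 : (3 : ℕ) ≠ 2 := by norm_num
  have hS : Additive.SubSemistableTwist W 3 := Or.inr hG
  -- the Heegner/twist datum with `d_K ≡ 1 (mod 8)`
  obtain ⟨N, _, K, _, _, Dt, H, ι, P, Wd, _, _, hN, hKiq, hodd, hunit, hHe, hLtw, hP, hnt, hWd, hrd, hXd, hSd, h8⟩ :=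
    exists_heegnerTwistDataManin_discr_emod_eight hFH hpar hHP hGZ hmod W 3 hr hp2 hX hS
  have hdK : NumberField.discr K ≠ -3 := discr_ne_neg_three_of_emod_eight h8
  have hloc : Additive.N10.Locus W 3 :=
    (Additive.N10.locus_iff_cells W 3).mpr
      ((Additive.N10.cellM_or_cellGordTwo_of_classX3_of_subSemistableTwist W 3 hp2 hX hS).elim Or.inl
        (fun h ↦ Or.inr (Or.inl h)))
  -- STEP L at THIS datum
  have hfin : (W.baseChange K).ShaFinite := (hKo N W K hKiq hHe ⟨Dt, H, ι, hP⟩ hnt).2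
  have hidx : IndexLowerBoundLeAt W 3 K P (padicValNat 3 Dt.c.natAbs) := by
    refine indexLowerBoundLeAt_of_frames_of_shaFinite_le hloc hN hKiq hHe hfin ?_ ?_
    · intro κ hκ γ _ 𝔭 h𝔭 he hf
      exact additiveIMCLowerBDPOnTree_subGordTwo_three_offSliver_of_thm212 hKo hmodD hA hL hCHσ hDVD hAN hBR h212 hprop125 hfact hlift
        hlocal h411 h263 h41 h42 h5A h32 W hr hX hG hna N K Dt H ι P hr hloc hN hKiq hodd hunit hHe hLtw hP hnt hdK κ hκ γ 𝔭 h𝔭 he hf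
    · intro κ hκ γ _ 𝔭 h𝔭 he hf
      exact additiveControlLeOnTreeAt_of_pt_of_kolyvagin pt_selmer_forall hKo W 3 hr hp2 hX hS N K Dt H ι P hr hloc hN hKiq
        hodd hunit hHe hLtw hP hnt κ hκ γ 𝔭 h𝔭 he hf
  have hJ' : JointLowerBoundAt W Wd 3 :=
    hJ hGZ hKo hGZK hmod hmodD hCas hGZ73 W 3 N K Dt H ι P Wd hr hN hKiq hodd hunit hHe hLtw hP hnt hWd hrd hp2 hidx
  exact missingLowerBoundAt_of_joint_of_upper hJ' (hU hDel hGZK hmod hmodD hW16 hWu Wd 3 hrd hp2 hXd hSd)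

/-! ### §2 Both halves per pair at `p = 3`: `MissingPPartAt W 3` and Miller's `BSD(E, 3)` -/

/-- **BOTH halves per pair on the (G-ord, `e = 2`) cell AT `p = 3`, non-anomalous twists: `MissingPPartAt W 3` (`ord₃ #Ш(E)_an = ord₃ #Ш(E)`)
⇐ `PrintedFacts` ∧ Hsieh ∧ LZZ ∧ Castella–Hsieh signed ∧ [DIV.dvd] (PREPRINT) ∧ [AN3] (PUB-composed) ∧ [BR3] (PUB) ∧ twelve published facts ∧
the pair's twist-unit datum** — §1 (lower) and generation 25's `UpperOfPrintNonAnomalousTwist.missingUpperBoundAt_gordTwo_odd_…` (upper, ⟸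
PUB ∪ {[DIV.dvd]} ∪ {TU, NAT}) through `missingPPartAt_of_lower_of_upper`.  On the census (686 non-anomalous (G-ord) pairs at `p = 3`) the
twist-unit datum is a kit certificate per pair; class-wide it is wing r2 (OPEN).  CONDITIONAL; closes no item; BSD not advanced beyond this
typed reduction. [claim: KellerYin2024PotOrd, status: under-review]
[cite: Miller2011LMS, Def. 1.1] [cite: KellerYin2024b, Thm. 3.3.6 and Prop. 3.4.4 (arXiv:2410.23241 p. 19) (preprint; hypothesis)]
[cite: CastellaGrossiLeeSkinner2022, Thms. 1.2.2, 2.1.2, 2.2.2, Prop. 14] -/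
theorem missingPPartAt_gordTwo_three_of_printedFacts_of_print_of_twistUnitAt_of_forall_twist (hF : PrintedFacts)
    (hA : Hsieh2014.thmA_exists_isHsiehLFunction_unrPeriod_anyLevel)
    (hL : LiuZhangZhang2018.thm151_thm153_modularCurve_heegnerVector_additive)
    (hCHσ : castellaHsieh2018_exists_isBranchBDPLFunction_signed)
    (hDVD : thm336_dvd_branch_OPEN) (hAN : thm351_anacong_branch_three) (hBR : thm122_charLambda_pair_three)
    (h212 : thm212_exists_isKatzLFunction)
    (hprop125 : prop125_characterGrSelmerDual_torsion_muZero_dim) (hfact : prop14_residualCharacterSelmer_finite)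
    (hlift : cor126_residualCharacter_globalLift) (hlocal : cor126_residualCharacter_localSurjective)
    (h411 : prop411_selmer_isAlmostDivisible) (h263 : prop263_sur_of_crk) (h41 : prop41_globalEulerPoincareCorank)
    (h42 : prop42_localEulerPoincareCorank) (h5A : sec5A_localH2_subsingleton_of_LOC1)
    (h32 : prop32_cohomology_isCofinitelyGenerated) :
    ∀ (W : WeierstrassCurve ℚ) [W.IsElliptic] [W.IsGloballyMinimal],
      W.analyticRank = 1 → ClassX3 W 3 → Additive.SubGordTwo W 3 →
      (∀ (V : WeierstrassCurve ℚ) [V.IsElliptic] [V.IsGloballyMinimal] (C : VariableChange ℚ),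
        GoodOrd V 3 → C • V.quadraticTwist ((-1 : ℚ) ^ (3 / 2) * (3 : ℕ)) = W → ¬ (3 : ℤ) ∣ V.frobeniusTrace 3 - 1) →
      Upper.TwistUnitFieldOffSliverAt W 3 → MissingPPartAt W 3 :=
  fun W _ _ hr hX hG hna hTU =>
    missingPPartAt_of_lower_of_upper W 3
      (missingLowerBoundAt_gordTwo_three_of_printedFacts_of_print_of_forall_twist hF hA hL hCHσ hDVD hAN hBR h212 hprop125 hfact hlift
        hlocal h411 h263 h41 h42 h5A h32 W hr hX hG hna)
      (missingUpperBoundAt_gordTwo_odd_of_printedFacts_of_twistUnitAt_of_forall_twist_of_hsieh_of_lzz_of_KY_dvd_of_prop14_of_castellaHsieh_signed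
        hF hA hL hDVD hfact hCHσ W 3 (by norm_num) hr hX hG hna hTU)

/-- **Miller's `BSD(E, 3)` per pair on the (G-ord, `e = 2`) cell, non-anomalous twists** — the previous theorem through `bsdp_of_missingPPartAt`
(rank = analytic rank and `Ш` finite by GZK, conjunct 3 of `PrintedFacts`).  NOT a proof of BSD for any curve: at each of the 686 non-anomalous
(G-ord) census pairs at `p = 3` it is BSD₃ MODULO {published theorems} ∪ {[DIV.dvd] (preprint), [AN3] (PUB-composed, audit pending)} ∪ {the
pair's twist-unit certificate}. [claim: KellerYin2024PotOrd, status: under-review]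
[cite: Miller2011LMS, §1 and Def. 1.1] [cite: KellerYin2024b, Thm. 3.3.6 and Prop. 3.4.4 (arXiv:2410.23241 p. 19) (preprint; hypothesis)] -/
theorem bsdp_gordTwo_three_of_printedFacts_of_print_of_twistUnitAt_of_forall_twist (hF : PrintedFacts)
    (hA : Hsieh2014.thmA_exists_isHsiehLFunction_unrPeriod_anyLevel)
    (hL : LiuZhangZhang2018.thm151_thm153_modularCurve_heegnerVector_additive)
    (hCHσ : castellaHsieh2018_exists_isBranchBDPLFunction_signed)
    (hDVD : thm336_dvd_branch_OPEN) (hAN : thm351_anacong_branch_three) (hBR : thm122_charLambda_pair_three)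
    (h212 : thm212_exists_isKatzLFunction)
    (hprop125 : prop125_characterGrSelmerDual_torsion_muZero_dim) (hfact : prop14_residualCharacterSelmer_finite)
    (hlift : cor126_residualCharacter_globalLift) (hlocal : cor126_residualCharacter_localSurjective)
    (h411 : prop411_selmer_isAlmostDivisible) (h263 : prop263_sur_of_crk) (h41 : prop41_globalEulerPoincareCorank)
    (h42 : prop42_localEulerPoincareCorank) (h5A : sec5A_localH2_subsingleton_of_LOC1)
    (h32 : prop32_cohomology_isCofinitelyGenerated) :
    ∀ (W : WeierstrassCurve ℚ) [W.IsElliptic] [W.IsGloballyMinimal],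
      W.analyticRank = 1 → ClassX3 W 3 → Additive.SubGordTwo W 3 →
      (∀ (V : WeierstrassCurve ℚ) [V.IsElliptic] [V.IsGloballyMinimal] (C : VariableChange ℚ),
        GoodOrd V 3 → C • V.quadraticTwist ((-1 : ℚ) ^ (3 / 2) * (3 : ℕ)) = W → ¬ (3 : ℤ) ∣ V.frobeniusTrace 3 - 1) →
      Upper.TwistUnitFieldOffSliverAt W 3 → BSDp W 3 :=
  fun W _ _ hr hX hG hna hTU =>
    bsdp_of_missingPPartAt W 3 hF.2.2.1 (le_of_eq hr)
      (missingPPartAt_gordTwo_three_of_printedFacts_of_print_of_twistUnitAt_of_forall_twist hF hA hL hCHσ hDVD hAN hBR h212 hprop125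
        hfact hlift hlocal h411 h263 h41 h42 h5A h32 W hr hX hG hna hTU)

/-! ### §3 The crux's own currency: `AdditiveIMCLowerBDPInputManinAt W 3` (the conclusion of crux r3 `GordTwoBranchIMC` at `p = 3`) for every
NON-ANOMALOUS pair of the (G-ord, `e = 2`) cell — the `d_K = −3` sliver is void at `p = 3` -/

/-- **Crux r3 `GordTwoBranchIMC` (item 19177) AT `p = 3` on the pairs with NON-ANOMALOUS twists, in the crux's own currency:
`AdditiveIMCLowerBDPInputManinAt W 3` for every globally minimal `W` with `r_an = 1`, `ClassX3 W 3`, `SubGordTwo W 3`, `NAT(W, 3)` ⇐ Kolyvagin ∧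
modularity ∧ Hsieh 2014 Thm. A ∧ Liu–Zhang–Zhang 2018 ∧ Castella–Hsieh signed ∧ [DIV.dvd] (PREPRINT) ∧ [AN3] (PUB-composed) ∧ [BR3] (PUB) ∧ twelve
published facts.**  The per-datum door `KYBranchThreeAux.additiveIMCLowerBDPOnTree_subGordTwo_three_offSliver_of_thm212` at EVERY Heegner datum of
the socket: its only extra hypothesis `d_K ≠ −3` is automatic at `p = 3` (the socket carries `3 ∤ #(𝓞_K^×)_tors`, and `ℚ(√−3)` has a unit of
order `3`: `SchneiderFree.sliver_void_at_three`).  This is the crux's conclusion on 686 of the cell's 2 411 pairs at `p = 3` (census kit j319291);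
the crux itself (all odd `p`, all pairs) stays OPEN.  CONDITIONAL on the displayed named statements; nothing asserted about BSD.
[claim: KellerYin2024PotOrd, status: under-review]
[cite: KellerYin2024b, Thm. 3.3.6, Prop. 3.4.4, Thm. 3.5.1, Assumption 2.0.3 (arXiv:2410.23241 pp. 8, 19–20) (preprint; the Kolyvagin clause a hypothesis)]
[cite: CastellaGrossiLeeSkinner2022, Thms. 1.2.2, 2.1.2, 2.2.2, Prop. 14] [cite: CastellaHsieh2018, §3.3, Def. 3.7, Prop. 3.8]
[cite: Hsieh2014, Thm. A p. 712 (Doc. Math. 19)] [cite: LiuZhangZhang2018, Thm 1.5.1 and Thm 1.5.3 (Duke Math. J. 167 pp. 748–749)]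
[cite: Cox2013, §7.A Lemma 7.5 (units of ℚ(√−3))] -/
theorem additiveIMCLowerBDPInputManinAt_gordTwo_three_of_print_of_forall_twist
    (hKo : ∀ (N : ℕ) [NeZero N] (W : WeierstrassCurve ℚ) (K : Type) [Field K] [NumberField K],
      Literature.NumberTheory.EllipticCurves.kolyvagin N W K)
    (hPar : nonempty_modularParametrizationData)
    (hA : Hsieh2014.thmA_exists_isHsiehLFunction_unrPeriod_anyLevel)
    (hL : LiuZhangZhang2018.thm151_thm153_modularCurve_heegnerVector_additive)
    (hCHσ : castellaHsieh2018_exists_isBranchBDPLFunction_signed)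
    (hDVD : thm336_dvd_branch_OPEN) (hAN : thm351_anacong_branch_three) (hBR : thm122_charLambda_pair_three)
    (h212 : thm212_exists_isKatzLFunction)
    (hprop125 : prop125_characterGrSelmerDual_torsion_muZero_dim) (hfact : prop14_residualCharacterSelmer_finite)
    (hlift : cor126_residualCharacter_globalLift) (hlocal : cor126_residualCharacter_localSurjective)
    (h411 : prop411_selmer_isAlmostDivisible) (h263 : prop263_sur_of_crk) (h41 : prop41_globalEulerPoincareCorank)
    (h42 : prop42_localEulerPoincareCorank) (h5A : sec5A_localH2_subsingleton_of_LOC1)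
    (h32 : prop32_cohomology_isCofinitelyGenerated) :
    ∀ (W : WeierstrassCurve ℚ) [W.IsElliptic] [W.IsGloballyMinimal],
      W.analyticRank = 1 → ClassX3 W 3 → Additive.SubGordTwo W 3 →
      (∀ (V : WeierstrassCurve ℚ) [V.IsElliptic] [V.IsGloballyMinimal] (C : VariableChange ℚ),
        GoodOrd V 3 → C • V.quadraticTwist ((-1 : ℚ) ^ (3 / 2) * (3 : ℕ)) = W → ¬ (3 : ℤ) ∣ V.frobeniusTrace 3 - 1) →
      AdditiveIMCLowerBDPInputManinAt W 3 := by
  intro W _ _ hr hX hS hna N _ K _ _ Dt H ι P hr' hloc hN hK hodd hunit hHe hL1 hP hnt κ hκ γ _ 𝔭 h𝔭 he hf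
  -- the `d_K = −3` sliver is void at `p = 3`
  have hdK : NumberField.discr K ≠ -3 := fun hd ↦ sliver_void_at_three hK hd rfl hunit
  exact additiveIMCLowerBDPOnTree_subGordTwo_three_offSliver_of_thm212 hKo hPar hA hL hCHσ hDVD hAN hBR h212 hprop125 hfact hlift
    hlocal h411 h263 h41 h42 h5A h32 W hr hX hS hna N K Dt H ι P hr' hloc hN hK hodd hunit hHe hL1 hP hnt hdK κ hκ γ 𝔭 h𝔭 he hf

/-- **The same from `PrintedFacts`** (Kolyvagin and the parametrisation datum are its conjuncts 2 and 5): crux r3's conclusion at `p = 3` on the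
non-anomalous pairs of the (G-ord, `e = 2`) cell ⟸ `PrintedFacts` ∧ Hsieh A ∧ LZZ ∧ Castella–Hsieh signed ∧ [DIV.dvd] ∧ [AN3] ∧ [BR3] ∧ twelve
published facts.  CONDITIONAL; the crux stays OPEN; BSD not advanced. [claim: KellerYin2024PotOrd, status: under-review]
[cite: KellerYin2024b, Thm. 3.3.6, Prop. 3.4.4 (arXiv:2410.23241 p. 19) (preprint; hypothesis)] [cite: CastellaGrossiLeeSkinner2022, Thms. 1.2.2, 2.1.2, 2.2.2, Prop. 14] -/
theorem additiveIMCLowerBDPInputManinAt_gordTwo_three_of_printedFacts_of_print_of_forall_twist (hF : PrintedFacts)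
    (hA : Hsieh2014.thmA_exists_isHsiehLFunction_unrPeriod_anyLevel)
    (hL : LiuZhangZhang2018.thm151_thm153_modularCurve_heegnerVector_additive)
    (hCHσ : castellaHsieh2018_exists_isBranchBDPLFunction_signed)
    (hDVD : thm336_dvd_branch_OPEN) (hAN : thm351_anacong_branch_three) (hBR : thm122_charLambda_pair_three)
    (h212 : thm212_exists_isKatzLFunction)
    (hprop125 : prop125_characterGrSelmerDual_torsion_muZero_dim) (hfact : prop14_residualCharacterSelmer_finite)
    (hlift : cor126_residualCharacter_globalLift) (hlocal : cor126_residualCharacter_localSurjective)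
    (h411 : prop411_selmer_isAlmostDivisible) (h263 : prop263_sur_of_crk) (h41 : prop41_globalEulerPoincareCorank)
    (h42 : prop42_localEulerPoincareCorank) (h5A : sec5A_localH2_subsingleton_of_LOC1)
    (h32 : prop32_cohomology_isCofinitelyGenerated) :
    ∀ (W : WeierstrassCurve ℚ) [W.IsElliptic] [W.IsGloballyMinimal],
      W.analyticRank = 1 → ClassX3 W 3 → Additive.SubGordTwo W 3 →
      (∀ (V : WeierstrassCurve ℚ) [V.IsElliptic] [V.IsGloballyMinimal] (C : VariableChange ℚ),
        GoodOrd V 3 → C • V.quadraticTwist ((-1 : ℚ) ^ (3 / 2) * (3 : ℕ)) = W → ¬ (3 : ℤ) ∣ V.frobeniusTrace 3 - 1) →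
      AdditiveIMCLowerBDPInputManinAt W 3 :=
  additiveIMCLowerBDPInputManinAt_gordTwo_three_of_print_of_forall_twist hF.2.1 hF.2.2.2.2.1 hA hL hCHσ hDVD hAN hBR h212 hprop125 hfact
    hlift hlocal h411 h263 h41 h42 h5A h32

/-! ### §4 Two of the twelve «published facts» are TREE THEOREMS: Greenberg 2006 Prop. 4.2 (`prop42_localEulerPoincareCorank_holds`) and §5 A
(`sec5A_localH2_subsingleton_of_LOC1_holds`) — the crux's currency and `BSD(E, 3)` per pair on TEN named facts -/

/-- **Crux r3's conclusion `AdditiveIMCLowerBDPInputManinAt W 3` on the non-anomalous pairs of the (G-ord, `e = 2`) cell, with Greenberg 2006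
Prop. 4.2 and §5 A DISCHARGED by the tree's theorems** (`Greenberg2006.prop42_localEulerPoincareCorank_holds`,
`Greenberg2006.sec5A_localH2_subsingleton_of_LOC1_holds`): ⟸ Kolyvagin ∧ modularity ∧ Hsieh A ∧ LZZ ∧ Castella–Hsieh signed ∧ [DIV.dvd] (PREPRINT) ∧
[AN3] (PUB-composed) ∧ [BR3] (PUB) ∧ TEN published named facts (CGLS 2022 Thm. 2.1.2, Prop. 1.2.5, Prop. 14, Cor. 1.2.6 ×2; Greenberg 2016 Props.
4.1.1, 2.6.3; Greenberg 2006 Props. 4.1, 3.2).  §3 with `h42`, `h5A` supplied.  CONDITIONAL; the crux stays OPEN; BSD not advanced.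
[claim: KellerYin2024PotOrd, status: under-review]
[cite: Greenberg2006, §4 A Prop. 4.2 (p. 368) and §5 A (pp. 372–373)] [cite: KellerYin2024b, Thm. 3.3.6, Prop. 3.4.4 (arXiv:2410.23241 p. 19) (preprint; hypothesis)]
[cite: CastellaGrossiLeeSkinner2022, Thms. 1.2.2, 2.1.2, 2.2.2, Prop. 14] -/
theorem additiveIMCLowerBDPInputManinAt_gordTwo_three_of_print_of_forall_twist_tenFacts
    (hKo : ∀ (N : ℕ) [NeZero N] (W : WeierstrassCurve ℚ) (K : Type) [Field K] [NumberField K],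
      Literature.NumberTheory.EllipticCurves.kolyvagin N W K)
    (hPar : nonempty_modularParametrizationData)
    (hA : Hsieh2014.thmA_exists_isHsiehLFunction_unrPeriod_anyLevel)
    (hL : LiuZhangZhang2018.thm151_thm153_modularCurve_heegnerVector_additive)
    (hCHσ : castellaHsieh2018_exists_isBranchBDPLFunction_signed)
    (hDVD : thm336_dvd_branch_OPEN) (hAN : thm351_anacong_branch_three) (hBR : thm122_charLambda_pair_three)
    (h212 : thm212_exists_isKatzLFunction)
    (hprop125 : prop125_characterGrSelmerDual_torsion_muZero_dim) (hfact : prop14_residualCharacterSelmer_finite)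
    (hlift : cor126_residualCharacter_globalLift) (hlocal : cor126_residualCharacter_localSurjective)
    (h411 : prop411_selmer_isAlmostDivisible) (h263 : prop263_sur_of_crk) (h41 : prop41_globalEulerPoincareCorank)
    (h32 : prop32_cohomology_isCofinitelyGenerated) :
    ∀ (W : WeierstrassCurve ℚ) [W.IsElliptic] [W.IsGloballyMinimal],
      W.analyticRank = 1 → ClassX3 W 3 → Additive.SubGordTwo W 3 →
      (∀ (V : WeierstrassCurve ℚ) [V.IsElliptic] [V.IsGloballyMinimal] (C : VariableChange ℚ),
        GoodOrd V 3 → C • V.quadraticTwist ((-1 : ℚ) ^ (3 / 2) * (3 : ℕ)) = W → ¬ (3 : ℤ) ∣ V.frobeniusTrace 3 - 1) →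
      AdditiveIMCLowerBDPInputManinAt W 3 :=
  additiveIMCLowerBDPInputManinAt_gordTwo_three_of_print_of_forall_twist hKo hPar hA hL hCHσ hDVD hAN hBR h212 hprop125 hfact hlift hlocal
    h411 h263 h41 Greenberg2006.prop42_localEulerPoincareCorank_holds Greenberg2006.sec5A_localH2_subsingleton_of_LOC1_holds h32

/-- **Miller's `BSD(E, 3)` per pair on the (G-ord, `e = 2`) cell, non-anomalous twists, on TEN published named facts** (Greenberg 2006 Prop. 4.2
and §5 A discharged by the tree's theorems) ∪ `PrintedFacts` ∪ Hsieh A ∪ LZZ ∪ Castella–Hsieh signed ∪ {[DIV.dvd], [AN3], [BR3]} ∪ the pair's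
twist-unit datum.  §2 with `h42`, `h5A` supplied.  NOT a proof of BSD for any curve (modulo the displayed hypotheses).
[claim: KellerYin2024PotOrd, status: under-review] [cite: Miller2011LMS, §1 and Def. 1.1]
[cite: Greenberg2006, §4 A Prop. 4.2 (p. 368) and §5 A (pp. 372–373)] [cite: KellerYin2024b, Thm. 3.3.6, Prop. 3.4.4 (arXiv:2410.23241 p. 19) (preprint; hypothesis)] -/
theorem bsdp_gordTwo_three_of_printedFacts_of_print_of_twistUnitAt_of_forall_twist_tenFacts (hF : PrintedFacts)
    (hA : Hsieh2014.thmA_exists_isHsiehLFunction_unrPeriod_anyLevel)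
    (hL : LiuZhangZhang2018.thm151_thm153_modularCurve_heegnerVector_additive)
    (hCHσ : castellaHsieh2018_exists_isBranchBDPLFunction_signed)
    (hDVD : thm336_dvd_branch_OPEN) (hAN : thm351_anacong_branch_three) (hBR : thm122_charLambda_pair_three)
    (h212 : thm212_exists_isKatzLFunction)
    (hprop125 : prop125_characterGrSelmerDual_torsion_muZero_dim) (hfact : prop14_residualCharacterSelmer_finite)
    (hlift : cor126_residualCharacter_globalLift) (hlocal : cor126_residualCharacter_localSurjective)
    (h411 : prop411_selmer_isAlmostDivisible) (h263 : prop263_sur_of_crk) (h41 : prop41_globalEulerPoincareCorank)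
    (h32 : prop32_cohomology_isCofinitelyGenerated) :
    ∀ (W : WeierstrassCurve ℚ) [W.IsElliptic] [W.IsGloballyMinimal],
      W.analyticRank = 1 → ClassX3 W 3 → Additive.SubGordTwo W 3 →
      (∀ (V : WeierstrassCurve ℚ) [V.IsElliptic] [V.IsGloballyMinimal] (C : VariableChange ℚ),
        GoodOrd V 3 → C • V.quadraticTwist ((-1 : ℚ) ^ (3 / 2) * (3 : ℕ)) = W → ¬ (3 : ℤ) ∣ V.frobeniusTrace 3 - 1) →
      Upper.TwistUnitFieldOffSliverAt W 3 → BSDp W 3 :=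
  bsdp_gordTwo_three_of_printedFacts_of_print_of_twistUnitAt_of_forall_twist hF hA hL hCHσ hDVD hAN hBR h212 hprop125 hfact hlift hlocal h411
    h263 h41 Greenberg2006.prop42_localEulerPoincareCorank_holds Greenberg2006.sec5A_localH2_subsingleton_of_LOC1_holds h32

end Summit.BirchSwinnertonDyer.BirchSwinnertonDyer.Theorems.SchneiderFreeAdditiveX3.KYBranchThreePerPair

end
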